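import Summits.CriticalPhenomena.PercolationContinuityZ3.Theorems.PercNearOneGluingNoHeavyLowerTailFrontierDecRowsRow37NoCutVertex
import Summits.CriticalPhenomena.PercolationContinuityZ3.Theorems.PercNearOneGluingNoHeavyLowerTailFrontierDecRowsRow37CutVertexAB
import HarnessLib

/-!
# Frontier dec row 37 reduces to cut-free weighted graphs MODULO ROW 15 ONLY (route `PercNearOneGluingNoHeavy`, supports-only; prim-l12-p6 g16)

`frontier_37_all_of_noCut` (`…Row37NoCutVertex`) reduces row 37 `E₃(D[ab|c], D[ac|y], D[ay|b]) ≥ 0` to cut-free weighted graphs under two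
hypotheses: row 15 everywhere (`R15`, needed by the hub identity) and the `{a,b}|{c,y}` cut case (`H22ab`).  The latter is now the kernel theorem
`sahiE3_row37_nonneg_of_cutVertexAB` (`…Row37CutVertexAB`, 117-term certificate), so only row 15 remains:
THEOREM (`frontier_37_all_of_row15_of_noCut`): if row 15 holds on every finite weighted graph and row 37 holds for every weight admitting no cut
colouring, then row 37 holds on every finite weighted graph.  Also recorded: the other two `2|2` splits of row 37 (`{a,c}|{b,y}`, `{a,y}|{b,c}`)
via the 3-cycle symmetry.  Memo `run/shared/lean/prim/prim-l12/FROM-prim-l12-p6-g16-ROW37-HUB-IDENTITY.md` §4–5.  No definitions, no named facts, no sorries.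
-/

noncomputable section

namespace Summit.CriticalPhenomena.PercolationContinuityZ3.Theorems.FrontierDecRows

open MeasureTheory CovTransferCert E3GroupSepCert
open Literature.Probability.Percolation Literature.Probability.LatticeModels

variable {n : ℕ}

/-- Row 37 across an `{a,c} | {b,y}` cut vertex (from the `{a,b}|{c,y}` case by the 3-cycle). [this work] -/
theorem sahiE3_row37_nonneg_of_cutVertexAC (w : Sym2 (Fin n) → unitInterval) (a b c y h : Fin n) (side : Fin n → Bool)
    (ha : side a = true) (hc : side c = true) (hb : side b = false) (hy : side y = false)
    (hw : ∀ u v : Fin n, u ≠ h → v ≠ h → side u ≠ side v → w s(u, v) = 0) :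
    0 ≤ sahiE3 (prodBernoulli w) (connEvent (row 37 n (a, b, c, y)).1) (connEvent (row 37 n (a, b, c, y)).2.1)
      (connEvent (row 37 n (a, b, c, y)).2.2) := by
  rw [← sahiE3_row37_cycle]
  exact sahiE3_row37_nonneg_of_cutVertexAB w a c y b h side ha hc hy hb hw

/-- Row 37 across an `{a,y} | {b,c}` cut vertex (from the `{a,b}|{c,y}` case by the 3-cycle, twice). [this work] -/
theorem sahiE3_row37_nonneg_of_cutVertexAY (w : Sym2 (Fin n) → unitInterval) (a b c y h : Fin n) (side : Fin n → Bool)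
    (ha : side a = true) (hy : side y = true) (hb : side b = false) (hc : side c = false)
    (hw : ∀ u v : Fin n, u ≠ h → v ≠ h → side u ≠ side v → w s(u, v) = 0) :
    0 ≤ sahiE3 (prodBernoulli w) (connEvent (row 37 n (a, b, c, y)).1) (connEvent (row 37 n (a, b, c, y)).2.1)
      (connEvent (row 37 n (a, b, c, y)).2.2) := by
  rw [← sahiE3_row37_cycle, ← sahiE3_row37_cycle]
  exact sahiE3_row37_nonneg_of_cutVertexAB w a y b c h side ha hy hb hc hw

/-- **Row 37 reduces to cut-free weighted graphs, modulo row 15.**  If row 15 `E₃(D[ab|c], D[ac|y], D[b|y]) ≥ 0` holds on every finite weighted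
graph and row 37 holds for every weight admitting no cut colouring, then row 37 holds on every finite weighted graph. [this work] -/
theorem frontier_37_all_of_row15_of_noCut
    (R15 : ∀ (n : ℕ) (w : Sym2 (Fin n) → unitInterval) (a b c y : Fin n),
      0 ≤ sahiE3 (prodBernoulli w) (connEvent (row 15 n (a, b, c, y)).1) (connEvent (row 15 n (a, b, c, y)).2.1)
        (connEvent (row 15 n (a, b, c, y)).2.2))
    (H : ∀ (n : ℕ) (w : Sym2 (Fin n) → unitInterval) (a b c y : Fin n),
      (∀ (h : Fin n) (side : Fin n → Bool), (∀ u v : Fin n, u ≠ h → v ≠ h → side u ≠ side v → w s(u, v) = 0) →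
        (∃ u v : Fin n, u ≠ h ∧ side u = true ∧ 0 < (w s(u, v) : ℝ)) →
        (∃ u v : Fin n, u ≠ h ∧ side u = false ∧ 0 < (w s(u, v) : ℝ)) → False) →
      0 ≤ sahiE3 (prodBernoulli w) (connEvent (row 37 n (a, b, c, y)).1) (connEvent (row 37 n (a, b, c, y)).2.1)
        (connEvent (row 37 n (a, b, c, y)).2.2))
    (n : ℕ) (w : Sym2 (Fin n) → unitInterval) (a b c y : Fin n) :
    0 ≤ sahiE3 (prodBernoulli w) (connEvent (row 37 n (a, b, c, y)).1) (connEvent (row 37 n (a, b, c, y)).2.1)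
      (connEvent (row 37 n (a, b, c, y)).2.2) :=
  frontier_37_all_of_noCut R15 (fun _ w a b c y h side ha hb hc hy hw => sahiE3_row37_nonneg_of_cutVertexAB w a b c y h side ha hb hc hy hw)
    H n w a b c y

end Summit.CriticalPhenomena.PercolationContinuityZ3.Theorems.FrontierDecRows

end
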